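import Literature.NumberTheory.Transcendental.CurvePeriodsProofs
import Mathlib.Analysis.Calculus.ParametricIntegral
import Mathlib.Analysis.Calculus.ParametricIntervalIntegral
import Mathlib.Analysis.Calculus.MeanValue
import Mathlib.Analysis.Calculus.Deriv.Prod
import Mathlib.Analysis.Calculus.Deriv.Slope
import Mathlib.MeasureTheory.Integral.DominatedConvergence
import Mathlib.LinearAlgebra.Matrix.Rank
import Mathlib.LinearAlgebra.Dimension.FreeAndStrongRankCondition
import HarnessLib

/-!
# Periods of curve type: Stokes' theorem on a triangle for `C¹` maps (relation (R5))

Companion of `CurvePeriods.lean` / `CurvePeriodsProofs.lean` (Huber–Wüstholz 2022, Thm. 13.3 (2),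
rendered on explicit period symbols). This file proves that the last generator (R5) `boundary` of
`CurvePeriods.IsElementaryRelation` evaluates to zero, i.e. `∫_{∂τ} ω = 0` for a `C¹` map `τ` of
the standard triangle into a smooth affine curve `Z` and a polynomial 1-form `ω`, and concludes
the EASY direction of the theorem: every `ℚ̄`-combination of elementary relations evaluates to `0`
(`CurvePeriods.IsElementaryRelation.evalCombination_eq_zero`,
`CurvePeriods.evalCombination_eq_zero_of_isElementaryRelation`), the converse of the named fact
`HuberWustholzCurvePeriods`; granted the fact, `HuberWustholzCurvePeriods.evalCombination_eq_zero_iff`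
(kernel of the evaluation map = `ℚ̄`-span of the elementary relations).

## The argument (book §3.3: "By Stokes's Theorem the pairing induces a well-defined map on
homology", here for merely `C¹` simplices)

* `square_stokes`: for `σ : [0,1]² → ℂⁿ` of class `C¹` on the closed square and a polynomial
  1-form `ω` such that `dω(∂ᵤσ, ∂ᵥσ) = 0` pointwise, the integral of `σ^*ω` over the boundary of
  the square vanishes. Since `σ` is only `C¹`, Green's formula is not available; instead, for
  `J(v) = ∫₀¹ ω(σ)·∂ᵤσ du` one integrates by parts in `u` the increment `J(v) − J(v₀)` (this only
  differentiates `σ(u,v) − σ(u,v₀)` in `u`), differentiates the resulting parametric integrals at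
  `v₀` (dominated convergence with a one-point Lipschitz bound), and finds
  `J′(v₀) = ω(σ)·∂ᵥσ |_{u=0}^{u=1}` thanks to `dω(∂ᵤσ, ∂ᵥσ) = 0`; the fundamental theorem of
  calculus in `v` finishes.
* `tangent_parallel`: by the Jacobian rank condition the tangent space of `Z` at a point is a
  complex line, so `dω` vanishes on pairs of tangent vectors; the partial derivatives of a `C¹`
  map into `Z` are tangent (chain rule on `Fⱼ ∘ σ ≡ 0`).
* The triangle is the image of the square under `(u, v) ↦ ((1 − v)u, v)`, which collapses the
  top edge to the vertex `v₂`; the three remaining edges are `e₀₁`, `e₁₂`, `e₀₂`.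

## References

* A. Huber, G. Wüstholz, *Transcendence and Linear Relations of 1-Periods*, Cambridge Tracts in
  Mathematics 227, CUP 2022 [HuberWustholz2022], §3.3–3.3.1 (pp. 42–43 of the held text),
  §13.1 (A)–(B) (p. 120), Thm. 13.3 (p. 121).
-/

noncomputable section

open scoped BigOperators Topology
open MvPolynomial Set MeasureTheory Filter

namespace Literature.NumberTheory.Transcendental

namespace CurvePeriods

/-! ### One-variable calculus lemmas -/

/-- Chain rule for a multivariate polynomial along a path, one-sided version. [folklore] -/
theorem hasDerivWithinAt_eval_comp {n : ℕ} {γ : ℝ → (Fin n → ℂ)} {γ' : Fin n → ℂ} {t : ℝ}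
    {s : Set ℝ} (hγ : ∀ i, HasDerivWithinAt (fun u => γ u i) (γ' i) s t)
    (P : MvPolynomial (Fin n) ℂ) :
    HasDerivWithinAt (fun u => eval (γ u) P) (∑ i, eval (γ t) (pderiv i P) * γ' i) s t := by
  induction P using MvPolynomial.induction_on with
  | C a =>
    simp only [eval_C, pderiv_C, map_zero, zero_mul, Finset.sum_const_zero]
    exact hasDerivWithinAt_const t s a
  | add p q hp hq =>
    have h := hp.add hq
    simp only [map_add, add_mul, Finset.sum_add_distrib]
    exact h
  | mul_X p i hp =>
    have h := hp.mul (hγ i)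
    have key : ∀ k, eval (γ t) (pderiv k (p * X i)) * γ' k =
        eval (γ t) (pderiv k p) * γ' k * γ t i +
          (if k = i then eval (γ t) p * γ' i else 0) := by
      intro k
      rw [pderiv_mul, map_add, map_mul, map_mul, eval_X]
      by_cases hk : k = i
      · subst hk
        rw [pderiv_X_self, map_one, if_pos rfl]
        ring
      · rw [pderiv_X_of_ne (fun h => hk h.symm), map_zero, if_neg hk]
        ring
    have hsum : (∑ k, eval (γ t) (pderiv k (p * X i)) * γ' k) =
        (∑ k, eval (γ t) (pderiv k p) * γ' k) * γ t i + eval (γ t) p * γ' i := by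
      rw [Finset.sum_congr rfl fun k _ => key k, Finset.sum_add_distrib, Finset.sum_mul,
        Finset.sum_ite_eq' Finset.univ i, if_pos (Finset.mem_univ _)]
    rw [hsum]
    have hfun : (fun u => eval (γ u) (p * X i)) = fun u => eval (γ u) p * γ u i := by
      funext u
      rw [map_mul, eval_X]
    rw [hfun]
    exact h

/-- Product rule at a zero: if `g(x) = 0`, `g` is differentiable at `x` and `h` is merely
continuous at `x`, then `g · h` is differentiable at `x` with derivative `g′(x) h(x)`.
[folklore] -/
theorem hasDerivAt_mul_of_eq_zero {g h : ℝ → ℂ} {g' : ℂ} {x : ℝ} (hg : HasDerivAt g g' x)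
    (hg0 : g x = 0) (hh : ContinuousAt h x) :
    HasDerivAt (fun y => g y * h y) (g' * h x) x := by
  rw [hasDerivAt_iff_tendsto_slope] at hg ⊢
  have hslope : slope (fun y => g y * h y) x = fun y => slope g x y * h y := by
    funext y
    simp only [slope, vsub_eq_sub, hg0, zero_mul, sub_zero, smul_mul_assoc]
  rw [hslope]
  exact hg.mul (hh.tendsto.mono_left nhdsWithin_le_nhds)

/-- Differentiation under the integral sign at a point `x₀`, for an integrand that is
differentiable in the parameter at `x₀` only and satisfies the one-point Lipschitz bound
`‖F x a − F x₀ a‖ ≤ bound a · |x − x₀|` (the `HasDerivAt` form of Mathlib's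
`hasFDerivAt_integral_of_dominated_loc_of_lip'`). [folklore] -/
theorem hasDerivAt_integral_of_dominated_loc_of_lip_pt {μ : Measure ℝ} {F : ℝ → ℝ → ℂ}
    {F' : ℝ → ℂ} {x₀ : ℝ} {s : Set ℝ} {bound : ℝ → ℝ} (hs : s ∈ 𝓝 x₀)
    (hF_meas : ∀ x ∈ s, AEStronglyMeasurable (F x) μ) (hF_int : Integrable (F x₀) μ)
    (hF'_meas : AEStronglyMeasurable F' μ)
    (h_lipsch : ∀ᵐ a ∂μ, ∀ x ∈ s, ‖F x a - F x₀ a‖ ≤ bound a * ‖x - x₀‖)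
    (bound_integrable : Integrable bound μ)
    (h_diff : ∀ᵐ a ∂μ, HasDerivAt (F · a) (F' a) x₀) :
    HasDerivAt (fun x => ∫ a, F x a ∂μ) (∫ a, F' a ∂μ) x₀ := by
  set L : ℂ →L[ℝ] ℝ →L[ℝ] ℂ := ContinuousLinearMap.smulRightL ℝ ℝ ℂ 1
  have h_diff' : ∀ᵐ a ∂μ, HasFDerivAt (F · a) (L (F' a)) x₀ :=
    h_diff.mono fun a ha => ha.hasFDerivAt
  have hm : AEStronglyMeasurable (L ∘ F') μ := L.continuous.comp_aestronglyMeasurable hF'_meas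
  obtain ⟨hF'_int, key⟩ := hasFDerivAt_integral_of_dominated_loc_of_lip' hs hF_meas hF_int hm
    h_lipsch bound_integrable h_diff'
  replace hF'_int : Integrable F' μ := by
    rw [← integrable_norm_iff hm] at hF'_int
    simpa [L, (· ∘ ·), integrable_norm_iff hF'_meas] using! hF'_int
  simp_rw [hasDerivAt_iff_hasFDerivAt] at ⊢
  simpa only [(· ∘ ·), ContinuousLinearMap.integral_comp_comm _ hF'_int] using! key

/-! ### The tangent space of a smooth affine curve is a complex line -/

/-- At a point of a smooth affine curve any two tangent vectors are parallel (the tangent space,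
the kernel of a Jacobian matrix of rank `n − 1`, has dimension `≤ 1`); stated coordinatewise.
[folklore] -/
theorem tangent_parallel {Z : CurveData} (hZ : Z.IsSmoothAffineCurve) {z : Fin Z.n → ℂ}
    (hz : z ∈ Z.points) {x y : Fin Z.n → ℂ} (hx : x ∈ Z.tangentSpace z)
    (hy : y ∈ Z.tangentSpace z) (i j : Fin Z.n) : x j * y i = y j * x i := by
  let G : Matrix (Fin Z.m) (Fin Z.n) ℂ := fun k l => Z.gradient k z l
  have hker : ∀ v, v ∈ LinearMap.ker G.mulVecLin ↔ v ∈ Z.tangentSpace z := by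
    intro v
    simp only [LinearMap.mem_ker, Matrix.mulVecLin_apply, CurveData.tangentSpace, mem_setOf_eq,
      funext_iff, Matrix.mulVec, dotProduct, Pi.zero_apply, G]
  have hrank : Module.finrank ℂ (LinearMap.range G.mulVecLin) = Z.n - 1 := by
    have h := Matrix.rank_eq_finrank_span_row G
    rw [Matrix.rank] at h
    rw [h]
    exact hZ.rank_eq z hz
  have hsum := LinearMap.finrank_range_add_finrank_ker G.mulVecLin
  rw [Module.finrank_fin_fun, hrank] at hsum
  have hfin : Module.finrank ℂ (LinearMap.ker G.mulVecLin) ≤ 1 := by omega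
  obtain ⟨v₀, hv₀⟩ := finrank_le_one_iff.1 hfin
  obtain ⟨a, ha⟩ := hv₀ ⟨x, (hker x).2 hx⟩
  obtain ⟨b, hb⟩ := hv₀ ⟨y, (hker y).2 hy⟩
  have hxa : x = a • (v₀ : Fin Z.n → ℂ) := by
    have := congrArg Subtype.val ha
    simpa using this.symm
  have hyb : y = b • (v₀ : Fin Z.n → ℂ) := by
    have := congrArg Subtype.val hb
    simpa using this.symm
  rw [hxa, hyb]
  simp only [Pi.smul_apply, smul_eq_mul]
  ring

/-! ### The standard triangle -/

/-- The standard triangle is convex. [folklore] -/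
theorem convex_stdTriangle : Convex ℝ stdTriangle := by
  intro p hp q hq a b ha hb hab
  simp only [stdTriangle, mem_setOf_eq, Prod.fst_add, Prod.snd_add, Prod.smul_fst, Prod.smul_snd,
    smul_eq_mul] at hp hq ⊢
  refine ⟨by nlinarith [hp.1, hq.1], by nlinarith [hp.2.1, hq.2.1], by nlinarith [hp.2.2, hq.2.2]⟩

/-- The standard triangle has non-empty interior. [folklore] -/
theorem interior_stdTriangle_nonempty : (interior stdTriangle).Nonempty := by
  refine ⟨((1 : ℝ) / 4, (1 : ℝ) / 4), ?_⟩
  rw [mem_interior_iff_mem_nhds]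
  have hopen : IsOpen ({p : ℝ × ℝ | 0 < p.1} ∩ ({p : ℝ × ℝ | 0 < p.2} ∩
      {p : ℝ × ℝ | p.1 + p.2 < 1})) :=
    (isOpen_lt continuous_const continuous_fst).inter
      ((isOpen_lt continuous_const continuous_snd).inter
        (isOpen_lt (continuous_fst.add continuous_snd) continuous_const))
  have hmem : ((1 : ℝ) / 4, (1 : ℝ) / 4) ∈ ({p : ℝ × ℝ | 0 < p.1} ∩ ({p : ℝ × ℝ | 0 < p.2} ∩
      {p : ℝ × ℝ | p.1 + p.2 < 1})) := by
    simp only [mem_inter_iff, mem_setOf_eq]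
    norm_num
  filter_upwards [hopen.mem_nhds hmem] with p hp
  exact ⟨hp.1.le, hp.2.1.le, hp.2.2.le⟩

/-- Derivatives within the standard triangle are unique. [folklore] -/
theorem uniqueDiffOn_stdTriangle : UniqueDiffOn ℝ stdTriangle :=
  uniqueDiffOn_convex convex_stdTriangle interior_stdTriangle_nonempty

/-! ### Slices of functions on the unit square -/

section Square

variable {X : Type*} [TopologicalSpace X]

/-- Horizontal slices of a function continuous on the unit square are continuous. [folklore] -/
theorem continuousOn_slice_fst {f : ℝ × ℝ → X}
    (hf : ContinuousOn f (Icc (0 : ℝ) 1 ×ˢ Icc (0 : ℝ) 1)) {v : ℝ} (hv : v ∈ Icc (0 : ℝ) 1) :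
    ContinuousOn (fun u => f (u, v)) (Icc 0 1) :=
  hf.comp (continuous_id.prodMk continuous_const).continuousOn fun _ hu => mk_mem_prod hu hv

/-- Vertical slices of a function continuous on the unit square are continuous. [folklore] -/
theorem continuousOn_slice_snd {f : ℝ × ℝ → X}
    (hf : ContinuousOn f (Icc (0 : ℝ) 1 ×ˢ Icc (0 : ℝ) 1)) {u : ℝ} (hu : u ∈ Icc (0 : ℝ) 1) :
    ContinuousOn (fun v => f (u, v)) (Icc 0 1) :=
  hf.comp (continuous_const.prodMk continuous_id).continuousOn fun _ hv => mk_mem_prod hu hv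

variable {n : ℕ} {σ : ℝ × ℝ → (Fin n → ℂ)} {σ' : ℝ × ℝ → (ℝ × ℝ →L[ℝ] (Fin n → ℂ))}

/-- Horizontal slices: one-sided derivative. [folklore] -/
theorem hasDerivWithinAt_slice_fst
    (hσ : ∀ p ∈ Icc (0 : ℝ) 1 ×ˢ Icc (0 : ℝ) 1, HasFDerivWithinAt σ (σ' p) (Icc 0 1 ×ˢ Icc 0 1) p)
    {u v : ℝ} (hu : u ∈ Icc (0 : ℝ) 1) (hv : v ∈ Icc (0 : ℝ) 1) (i : Fin n) :
    HasDerivWithinAt (fun u => σ (u, v) i) (σ' (u, v) (1, 0) i) (Icc 0 1) u := by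
  have hι : HasDerivWithinAt (fun u : ℝ => (u, v)) ((1 : ℝ), (0 : ℝ)) (Icc 0 1) u :=
    (hasDerivWithinAt_id u _).prodMk (hasDerivWithinAt_const u _ v)
  have h := (hσ (u, v) (mk_mem_prod hu hv)).comp_hasDerivWithinAt u hι fun u' hu' =>
    mk_mem_prod hu' hv
  exact hasDerivWithinAt_pi.1 h i

/-- Vertical slices: one-sided derivative. [folklore] -/
theorem hasDerivWithinAt_slice_snd
    (hσ : ∀ p ∈ Icc (0 : ℝ) 1 ×ˢ Icc (0 : ℝ) 1, HasFDerivWithinAt σ (σ' p) (Icc 0 1 ×ˢ Icc 0 1) p)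
    {u v : ℝ} (hu : u ∈ Icc (0 : ℝ) 1) (hv : v ∈ Icc (0 : ℝ) 1) (i : Fin n) :
    HasDerivWithinAt (fun v => σ (u, v) i) (σ' (u, v) (0, 1) i) (Icc 0 1) v := by
  have hι : HasDerivWithinAt (fun v : ℝ => (u, v)) ((0 : ℝ), (1 : ℝ)) (Icc 0 1) v :=
    (hasDerivWithinAt_const v _ u).prodMk (hasDerivWithinAt_id v _)
  have h := (hσ (u, v) (mk_mem_prod hu hv)).comp_hasDerivWithinAt v hι fun v' hv' =>
    mk_mem_prod hu hv'
  exact hasDerivWithinAt_pi.1 h i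

/-- Horizontal slices: derivative at interior points. [folklore] -/
theorem hasDerivAt_slice_fst
    (hσ : ∀ p ∈ Icc (0 : ℝ) 1 ×ˢ Icc (0 : ℝ) 1, HasFDerivWithinAt σ (σ' p) (Icc 0 1 ×ˢ Icc 0 1) p)
    {u v : ℝ} (hu : u ∈ Ioo (0 : ℝ) 1) (hv : v ∈ Icc (0 : ℝ) 1) (i : Fin n) :
    HasDerivAt (fun u => σ (u, v) i) (σ' (u, v) (1, 0) i) u :=
  (hasDerivWithinAt_slice_fst hσ (Ioo_subset_Icc_self hu) hv i).hasDerivAt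
    (Icc_mem_nhds hu.1 hu.2)

/-- Vertical slices: derivative at interior points. [folklore] -/
theorem hasDerivAt_slice_snd
    (hσ : ∀ p ∈ Icc (0 : ℝ) 1 ×ˢ Icc (0 : ℝ) 1, HasFDerivWithinAt σ (σ' p) (Icc 0 1 ×ˢ Icc 0 1) p)
    {u v : ℝ} (hu : u ∈ Icc (0 : ℝ) 1) (hv : v ∈ Ioo (0 : ℝ) 1) (i : Fin n) :
    HasDerivAt (fun v => σ (u, v) i) (σ' (u, v) (0, 1) i) v :=
  (hasDerivWithinAt_slice_snd hσ hu (Ioo_subset_Icc_self hv) i).hasDerivAt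
    (Icc_mem_nhds hv.1 hv.2)

/-- Vertical slices: one-sided derivative, vector form. [folklore] -/
theorem hasDerivWithinAt_slice_snd_vec
    (hσ : ∀ p ∈ Icc (0 : ℝ) 1 ×ˢ Icc (0 : ℝ) 1, HasFDerivWithinAt σ (σ' p) (Icc 0 1 ×ˢ Icc 0 1) p)
    {u v : ℝ} (hu : u ∈ Icc (0 : ℝ) 1) (hv : v ∈ Icc (0 : ℝ) 1) :
    HasDerivWithinAt (fun v => σ (u, v)) (σ' (u, v) (0, 1)) (Icc 0 1) v := by
  have hι : HasDerivWithinAt (fun v : ℝ => (u, v)) ((0 : ℝ), (1 : ℝ)) (Icc 0 1) v :=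
    (hasDerivWithinAt_const v _ u).prodMk (hasDerivWithinAt_id v _)
  exact (hσ (u, v) (mk_mem_prod hu hv)).comp_hasDerivWithinAt v hι fun v' hv' =>
    mk_mem_prod hu hv'

/-- **Stokes' theorem on the unit square for a `C¹` map and a polynomial 1-form whose exterior
derivative vanishes on the image tangent planes.** Let `σ : [0,1]² → ℂⁿ` be `C¹` on the closed
square (one-sided derivatives `σ′` on the boundary, `σ′` continuous) and `ω = Σ ωᵢ dxᵢ` a
polynomial 1-form such that `dω(∂ᵤσ, ∂ᵥσ) = 0` at every point of the square (hypothesis `hiso`,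
written out as `Σᵢⱼ ∂ⱼωᵢ(σ) (∂ᵥσⱼ ∂ᵤσᵢ − ∂ᵤσⱼ ∂ᵥσᵢ) = 0`). Then the integral of `σ^*ω` over the
oriented boundary of the square vanishes:
`∫₀¹ ω(σ)·∂ᵤσ (u,0) du − ∫₀¹ ω(σ)·∂ᵤσ (u,1) du + ∫₀¹ ω(σ)·∂ᵥσ (1,v) dv − ∫₀¹ ω(σ)·∂ᵥσ (0,v) dv = 0`.
No second derivatives of `σ` are used (see the module docstring for the argument). [folklore] -/
theorem square_stokes (ω : Fin n → MvPolynomial (Fin n) ℂ)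
    (hσ : ∀ p ∈ Icc (0 : ℝ) 1 ×ˢ Icc (0 : ℝ) 1, HasFDerivWithinAt σ (σ' p) (Icc 0 1 ×ˢ Icc 0 1) p)
    (hσ' : ContinuousOn σ' (Icc (0 : ℝ) 1 ×ˢ Icc (0 : ℝ) 1))
    (hiso : ∀ p ∈ Icc (0 : ℝ) 1 ×ˢ Icc (0 : ℝ) 1,
      (∑ i, (∑ j, eval (σ p) (pderiv j (ω i)) * σ' p (0, 1) j) * σ' p (1, 0) i) =
        ∑ i, (∑ j, eval (σ p) (pderiv j (ω i)) * σ' p (1, 0) j) * σ' p (0, 1) i) :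
    (∫ u in (0 : ℝ)..1, ∑ i, eval (σ (u, 0)) (ω i) * σ' (u, 0) (1, 0) i) -
        (∫ u in (0 : ℝ)..1, ∑ i, eval (σ (u, 1)) (ω i) * σ' (u, 1) (1, 0) i) +
      ((∫ v in (0 : ℝ)..1, ∑ i, eval (σ (1, v)) (ω i) * σ' (1, v) (0, 1) i) -
        (∫ v in (0 : ℝ)..1, ∑ i, eval (σ (0, v)) (ω i) * σ' (0, v) (0, 1) i)) = 0 := by
  have h01 : (0 : ℝ) ∈ Icc (0 : ℝ) 1 := ⟨le_rfl, zero_le_one⟩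
  have h11 : (1 : ℝ) ∈ Icc (0 : ℝ) 1 := ⟨zero_le_one, le_rfl⟩
  have hScpt : IsCompact (Icc (0 : ℝ) 1 ×ˢ Icc (0 : ℝ) 1) := isCompact_Icc.prod isCompact_Icc
  -- continuity of the building blocks on the square
  have hcσ : ContinuousOn σ (Icc (0 : ℝ) 1 ×ˢ Icc (0 : ℝ) 1) := fun p hp =>
    (hσ p hp).continuousWithinAt
  have hc_ev : ∀ P : MvPolynomial (Fin n) ℂ,
      ContinuousOn (fun p => eval (σ p) P) (Icc (0 : ℝ) 1 ×ˢ Icc (0 : ℝ) 1) := fun P =>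
    (continuous_eval P).comp_continuousOn hcσ
  have hc_co : ∀ i : Fin n, ContinuousOn (fun p => σ p i) (Icc (0 : ℝ) 1 ×ˢ Icc (0 : ℝ) 1) :=
    fun i => (continuous_apply i).comp_continuousOn hcσ
  have hc_dv : ∀ w : ℝ × ℝ, ContinuousOn (fun p => σ' p w) (Icc (0 : ℝ) 1 ×ˢ Icc (0 : ℝ) 1) :=
    fun w => hσ'.clm_apply continuousOn_const
  have hc_d : ∀ (w : ℝ × ℝ) (i : Fin n),
      ContinuousOn (fun p => σ' p w i) (Icc (0 : ℝ) 1 ×ˢ Icc (0 : ℝ) 1) := fun w i =>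
    (continuous_apply i).comp_continuousOn (hc_dv w)
  -- the named integrands
  obtain ⟨H, hH⟩ : ∃ H : ℝ × ℝ → ℂ, H = fun p => ∑ i, eval (σ p) (ω i) * σ' p (1, 0) i :=
    ⟨_, rfl⟩
  obtain ⟨G, hG⟩ : ∃ G : ℝ × ℝ → ℂ, G = fun p => ∑ i, eval (σ p) (ω i) * σ' p (0, 1) i :=
    ⟨_, rfl⟩
  obtain ⟨Du, hDu⟩ : ∃ Du : Fin n → ℝ × ℝ → ℂ,
      Du = fun i p => ∑ j, eval (σ p) (pderiv j (ω i)) * σ' p (1, 0) j := ⟨_, rfl⟩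
  obtain ⟨Dv, hDv⟩ : ∃ Dv : Fin n → ℝ × ℝ → ℂ,
      Dv = fun i p => ∑ j, eval (σ p) (pderiv j (ω i)) * σ' p (0, 1) j := ⟨_, rfl⟩
  have hcH : ContinuousOn H (Icc (0 : ℝ) 1 ×ˢ Icc (0 : ℝ) 1) := by
    rw [hH]; exact continuousOn_finsetSum _ fun i _ => (hc_ev (ω i)).mul (hc_d (1, 0) i)
  have hcG : ContinuousOn G (Icc (0 : ℝ) 1 ×ˢ Icc (0 : ℝ) 1) := by
    rw [hG]; exact continuousOn_finsetSum _ fun i _ => (hc_ev (ω i)).mul (hc_d (0, 1) i)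
  have hcDu : ∀ i, ContinuousOn (Du i) (Icc (0 : ℝ) 1 ×ˢ Icc (0 : ℝ) 1) := by
    intro i; rw [hDu]
    exact continuousOn_finsetSum _ fun j _ => (hc_ev _).mul (hc_d (1, 0) j)
  have hcDv : ∀ i, ContinuousOn (Dv i) (Icc (0 : ℝ) 1 ×ˢ Icc (0 : ℝ) 1) := by
    intro i; rw [hDv]
    exact continuousOn_finsetSum _ fun j _ => (hc_ev _).mul (hc_d (0, 1) j)
  -- derivatives of `eval (σ ·) (ω i)` along slices
  have hd_ev_u : ∀ {u v : ℝ} (_ : u ∈ Ioo (0 : ℝ) 1) (_ : v ∈ Icc (0 : ℝ) 1) (i : Fin n),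
      HasDerivAt (fun u => eval (σ (u, v)) (ω i)) (Du i (u, v)) u := by
    intro u v hu hv i
    rw [hDu]
    exact hasDerivAt_eval_comp (γ := fun u => σ (u, v))
      (fun j => hasDerivAt_slice_fst hσ hu hv j) (ω i)
  have hd_ev_v : ∀ {u v : ℝ} (_ : u ∈ Icc (0 : ℝ) 1) (_ : v ∈ Icc (0 : ℝ) 1) (i : Fin n),
      HasDerivWithinAt (fun v => eval (σ (u, v)) (ω i)) (Dv i (u, v)) (Icc 0 1) v := by
    intro u v hu hv i
    rw [hDv]
    exact hasDerivWithinAt_eval_comp (γ := fun v => σ (u, v))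
      (fun j => hasDerivWithinAt_slice_snd hσ hu hv j) (ω i)
  -- uniform bounds on the compact square
  obtain ⟨M₁, hM₁⟩ := hScpt.exists_bound_of_continuousOn (hc_dv (0, 1))
  obtain ⟨M₂, hM₂⟩ := hScpt.exists_bound_of_continuousOn (hc_dv (1, 0))
  obtain ⟨L₁, hL₁⟩ := hScpt.exists_bound_of_continuousOn
    (continuousOn_finsetSum Finset.univ fun i _ => (hcDv i).norm :
      ContinuousOn (fun p => ∑ i, ‖Dv i p‖) (Icc (0 : ℝ) 1 ×ˢ Icc (0 : ℝ) 1))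
  obtain ⟨L₂, hL₂⟩ := hScpt.exists_bound_of_continuousOn
    (continuousOn_finsetSum Finset.univ fun i _ => (hcDu i).norm :
      ContinuousOn (fun p => ∑ i, ‖Du i p‖) (Icc (0 : ℝ) 1 ×ˢ Icc (0 : ℝ) 1))
  have hM₁nn : 0 ≤ M₁ := (norm_nonneg _).trans (hM₁ (0, 0) (mk_mem_prod h01 h01))
  have hL₁' : ∀ p ∈ Icc (0 : ℝ) 1 ×ˢ Icc (0 : ℝ) 1, ∀ i, ‖Dv i p‖ ≤ L₁ := by
    intro p hp i
    have h := hL₁ p hp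
    rw [Real.norm_of_nonneg (Finset.sum_nonneg fun k _ => norm_nonneg _)] at h
    exact (Finset.single_le_sum (f := fun k => ‖Dv k p‖) (fun k _ => norm_nonneg _)
      (Finset.mem_univ i)).trans h
  have hL₂' : ∀ p ∈ Icc (0 : ℝ) 1 ×ˢ Icc (0 : ℝ) 1, (∑ i, ‖Du i p‖) ≤ L₂ := by
    intro p hp
    have h := hL₂ p hp
    rwa [Real.norm_of_nonneg (Finset.sum_nonneg fun k _ => norm_nonneg _)] at h
  have hL₁nn : 0 ≤ L₁ := (norm_nonneg _).trans (hL₁ (0, 0) (mk_mem_prod h01 h01))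
  -- mean value inequalities along vertical slices
  have hMVσ : ∀ {u v v' : ℝ} (_ : u ∈ Icc (0 : ℝ) 1) (_ : v ∈ Icc (0 : ℝ) 1)
      (_ : v' ∈ Icc (0 : ℝ) 1), ‖σ (u, v) - σ (u, v')‖ ≤ M₁ * ‖v - v'‖ := by
    intro u v v' hu hv hv'
    exact (convex_Icc 0 1).norm_image_sub_le_of_norm_hasDerivWithin_le
      (fun x hx => hasDerivWithinAt_slice_snd_vec hσ hu hx)
      (fun x hx => hM₁ (u, x) (mk_mem_prod hu hx)) hv' hv
  have hMVev : ∀ {u v v' : ℝ} (_ : u ∈ Icc (0 : ℝ) 1) (_ : v ∈ Icc (0 : ℝ) 1)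
      (_ : v' ∈ Icc (0 : ℝ) 1) (i : Fin n),
      ‖eval (σ (u, v)) (ω i) - eval (σ (u, v')) (ω i)‖ ≤ L₁ * ‖v - v'‖ := by
    intro u v v' hu hv hv' i
    exact (convex_Icc 0 1).norm_image_sub_le_of_norm_hasDerivWithin_le
      (fun x hx => hd_ev_v hu hx i) (fun x hx => hL₁' (u, x) (mk_mem_prod hu hx) i) hv' hv
  -- slices of the named functions
  have cH : ∀ {w : ℝ}, w ∈ Icc (0 : ℝ) 1 → ContinuousOn (fun u => H (u, w)) (Icc 0 1) :=
    fun hw => continuousOn_slice_fst hcH hw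
  have cev : ∀ {w : ℝ} (_ : w ∈ Icc (0 : ℝ) 1) (P : MvPolynomial (Fin n) ℂ),
      ContinuousOn (fun u => eval (σ (u, w)) P) (Icc 0 1) :=
    fun hw P => continuousOn_slice_fst (hc_ev P) hw
  have cco : ∀ {w : ℝ} (_ : w ∈ Icc (0 : ℝ) 1) (i : Fin n),
      ContinuousOn (fun u => σ (u, w) i) (Icc 0 1) := fun hw i => continuousOn_slice_fst (hc_co i) hw
  have cd : ∀ {w : ℝ} (_ : w ∈ Icc (0 : ℝ) 1) (w' : ℝ × ℝ) (i : Fin n),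
      ContinuousOn (fun u => σ' (u, w) w' i) (Icc 0 1) :=
    fun hw w' i => continuousOn_slice_fst (hc_d w' i) hw
  have cDu : ∀ {w : ℝ} (_ : w ∈ Icc (0 : ℝ) 1) (i : Fin n),
      ContinuousOn (fun u => Du i (u, w)) (Icc 0 1) := fun hw i => continuousOn_slice_fst (hcDu i) hw
  have cDv : ∀ {w : ℝ} (_ : w ∈ Icc (0 : ℝ) 1) (i : Fin n),
      ContinuousOn (fun u => Dv i (u, w)) (Icc 0 1) := fun hw i => continuousOn_slice_fst (hcDv i) hw
  ---------------------------------------------------------------------------------------------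
  -- Step 1: `J(v) = ∫₀¹ H(u, v) du` is continuous on `[0,1]`.
  ---------------------------------------------------------------------------------------------
  have hJ : ContinuousOn (fun v => ∫ u in (0 : ℝ)..1, H (u, v)) (Icc 0 1) := by
    obtain ⟨M, hM⟩ := hScpt.exists_bound_of_continuousOn hcH
    intro v₀ hv₀
    refine intervalIntegral.continuousWithinAt_of_dominated_interval
      (F := fun v u => H (u, v)) (bound := fun _ => M) ?_ ?_ ?_ ?_
    · refine eventually_nhdsWithin_of_forall fun v hv => ?_
      rw [uIoc_of_le zero_le_one]
      exact ((cH hv).mono Ioc_subset_Icc_self).aestronglyMeasurable measurableSet_Ioc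
    · refine eventually_nhdsWithin_of_forall fun v hv => ae_of_all _ fun u hu => ?_
      rw [uIoc_of_le zero_le_one] at hu
      exact hM (u, v) (mk_mem_prod (Ioc_subset_Icc_self hu) hv)
    · exact intervalIntegrable_const
    · refine ae_of_all _ fun u hu => ?_
      rw [uIoc_of_le zero_le_one] at hu
      exact continuousOn_slice_snd hcH (Ioc_subset_Icc_self hu) v₀ hv₀
  ---------------------------------------------------------------------------------------------
  -- Step 2: `J` is differentiable on `(0,1)` with `J′(v₀) = G(1, v₀) − G(0, v₀)`.
  ---------------------------------------------------------------------------------------------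
  have hJ' : ∀ v₀ ∈ Ioo (0 : ℝ) 1,
      HasDerivAt (fun v => ∫ u in (0 : ℝ)..1, H (u, v)) (G (1, v₀) - G (0, v₀)) v₀ := by
    intro v₀ hv₀
    have hv₀' : v₀ ∈ Icc (0 : ℝ) 1 := Ioo_subset_Icc_self hv₀
    have hnhds : Icc (0 : ℝ) 1 ∈ 𝓝 v₀ := Icc_mem_nhds hv₀.1 hv₀.2
    -- the three increments
    obtain ⟨T1, hT1⟩ : ∃ T1 : ℝ → ℂ, T1 = fun v => ∫ u in (0 : ℝ)..1,
        ∑ i, (eval (σ (u, v)) (ω i) - eval (σ (u, v₀)) (ω i)) * σ' (u, v) (1, 0) i := ⟨_, rfl⟩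
    obtain ⟨T2, hT2⟩ : ∃ T2 : ℝ → ℂ, T2 = fun v => ∫ u in (0 : ℝ)..1,
        ∑ i, Du i (u, v₀) * (σ (u, v) i - σ (u, v₀) i) := ⟨_, rfl⟩
    obtain ⟨T3, hT3⟩ : ∃ T3 : ℝ → ℂ, T3 = fun v =>
        (∑ i, eval (σ (1, v₀)) (ω i) * (σ (1, v) i - σ (1, v₀) i)) -
          ∑ i, eval (σ (0, v₀)) (ω i) * (σ (0, v) i - σ (0, v₀) i) := ⟨_, rfl⟩
    -- (BP): integration by parts in `u` of the increment `J(v) − J(v₀)`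
    have hBP : ∀ v ∈ Icc (0 : ℝ) 1, (∫ u in (0 : ℝ)..1, H (u, v)) =
        (∫ u in (0 : ℝ)..1, H (u, v₀)) + (T1 v - T2 v + T3 v) := by
      intro v hv
      have iA : IntervalIntegrable (fun u => ∑ i, (eval (σ (u, v)) (ω i) -
          eval (σ (u, v₀)) (ω i)) * σ' (u, v) (1, 0) i) volume 0 1 :=
        (continuousOn_finsetSum _ fun i _ =>
          ((cev hv _).sub (cev hv₀' _)).mul (cd hv _ i)).intervalIntegrable_of_Icc zero_le_one
      have iB : IntervalIntegrable (fun u => ∑ i, eval (σ (u, v₀)) (ω i) *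
          (σ' (u, v) (1, 0) i - σ' (u, v₀) (1, 0) i)) volume 0 1 :=
        (continuousOn_finsetSum _ fun i _ =>
          (cev hv₀' _).mul ((cd hv _ i).sub (cd hv₀' _ i))).intervalIntegrable_of_Icc zero_le_one
      have iT2 : IntervalIntegrable (fun u => ∑ i, Du i (u, v₀) *
          (σ (u, v) i - σ (u, v₀) i)) volume 0 1 :=
        (continuousOn_finsetSum _ fun i _ =>
          (cDu hv₀' i).mul ((cco hv i).sub (cco hv₀' i))).intervalIntegrable_of_Icc zero_le_one
      -- `J v − J v₀ = ∫ A + ∫ B`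
      have h1 : (∫ u in (0 : ℝ)..1, H (u, v)) - (∫ u in (0 : ℝ)..1, H (u, v₀)) =
          (∫ u in (0 : ℝ)..1, ∑ i, (eval (σ (u, v)) (ω i) - eval (σ (u, v₀)) (ω i)) *
            σ' (u, v) (1, 0) i) +
          ∫ u in (0 : ℝ)..1, ∑ i, eval (σ (u, v₀)) (ω i) *
            (σ' (u, v) (1, 0) i - σ' (u, v₀) (1, 0) i) := by
        rw [← intervalIntegral.integral_sub ((cH hv).intervalIntegrable_of_Icc zero_le_one)
          ((cH hv₀').intervalIntegrable_of_Icc zero_le_one), ← intervalIntegral.integral_add iA iB]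
        refine intervalIntegral.integral_congr fun u _ => ?_
        simp only [hH]
        rw [← Finset.sum_sub_distrib, ← Finset.sum_add_distrib]
        exact Finset.sum_congr rfl fun i _ => by ring
      -- fundamental theorem of calculus for `Ψ(u) = ω(σ(u,v₀)) · (σ(u,v) − σ(u,v₀))`
      have hΨ : (∫ u in (0 : ℝ)..1, ∑ i, (Du i (u, v₀) * (σ (u, v) i - σ (u, v₀) i) +
          eval (σ (u, v₀)) (ω i) * (σ' (u, v) (1, 0) i - σ' (u, v₀) (1, 0) i))) = T3 v := by
        have hF := intervalIntegral.integral_eq_sub_of_hasDerivAt_of_le zero_le_one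
          (f := fun u => ∑ i, eval (σ (u, v₀)) (ω i) * (σ (u, v) i - σ (u, v₀) i))
          (f' := fun u => ∑ i, (Du i (u, v₀) * (σ (u, v) i - σ (u, v₀) i) +
            eval (σ (u, v₀)) (ω i) * (σ' (u, v) (1, 0) i - σ' (u, v₀) (1, 0) i)))
          (continuousOn_finsetSum _ fun i _ => (cev hv₀' _).mul ((cco hv i).sub (cco hv₀' i)))
          (fun u hu => HasDerivAt.fun_sum fun i _ => (hd_ev_u hu hv₀' i).mul
            ((hasDerivAt_slice_fst hσ hu hv i).sub (hasDerivAt_slice_fst hσ hu hv₀' i)))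
          ((continuousOn_finsetSum _ fun i _ => ((cDu hv₀' i).mul ((cco hv i).sub
            (cco hv₀' i))).add ((cev hv₀' _).mul ((cd hv _ i).sub (cd hv₀' _ i)))
              ).intervalIntegrable_of_Icc zero_le_one)
        rw [hF, hT3]
      -- split `∫ Ψ′ = T2 v + ∫ B`
      have h2 : (∫ u in (0 : ℝ)..1, ∑ i, (Du i (u, v₀) * (σ (u, v) i - σ (u, v₀) i) +
          eval (σ (u, v₀)) (ω i) * (σ' (u, v) (1, 0) i - σ' (u, v₀) (1, 0) i))) =
          T2 v + ∫ u in (0 : ℝ)..1, ∑ i, eval (σ (u, v₀)) (ω i) *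
            (σ' (u, v) (1, 0) i - σ' (u, v₀) (1, 0) i) := by
        rw [hT2, ← intervalIntegral.integral_add iT2 iB]
        exact intervalIntegral.integral_congr fun u _ => Finset.sum_add_distrib
      have hT1v : T1 v = ∫ u in (0 : ℝ)..1, ∑ i, (eval (σ (u, v)) (ω i) -
          eval (σ (u, v₀)) (ω i)) * σ' (u, v) (1, 0) i := by rw [hT1]
      rw [h2] at hΨ
      linear_combination h1 - hT1v + hΨ
    -- (D3)
    have hD3 : HasDerivAt T3 (G (1, v₀) - G (0, v₀)) v₀ := by
      rw [hT3, hG]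
      refine (HasDerivAt.fun_sum fun i _ => ?_).sub (HasDerivAt.fun_sum fun i _ => ?_)
      · exact ((hasDerivAt_slice_snd hσ h11 hv₀ i).sub_const _).const_mul _
      · exact ((hasDerivAt_slice_snd hσ h01 hv₀ i).sub_const _).const_mul _
    -- (D2): differentiation under the integral sign, Lipschitz case
    have hD2 : HasDerivAt T2 (∫ u in (0 : ℝ)..1, ∑ i, Du i (u, v₀) * σ' (u, v₀) (0, 1) i) v₀ := by
      rw [hT2]
      have key := intervalIntegral.hasDerivAt_integral_of_dominated_loc_of_lip
        (μ := volume) (a := (0 : ℝ)) (b := 1)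
        (F := fun v u => ∑ i, Du i (u, v₀) * (σ (u, v) i - σ (u, v₀) i))
        (F' := fun u => ∑ i, Du i (u, v₀) * σ' (u, v₀) (0, 1) i) (x₀ := v₀)
        (bound := fun _ => L₂ * M₁) hnhds ?_ ?_ ?_ ?_ ?_ ?_
      · exact key.2
      · filter_upwards [hnhds] with v hv
        rw [uIoc_of_le zero_le_one]
        exact ((continuousOn_finsetSum _ fun i _ => (cDu hv₀' i).mul ((cco hv i).sub
          (cco hv₀' i))).mono Ioc_subset_Icc_self).aestronglyMeasurable measurableSet_Ioc
      · exact (continuousOn_finsetSum _ fun i _ => (cDu hv₀' i).mul ((cco hv₀' i).sub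
          (cco hv₀' i))).intervalIntegrable_of_Icc zero_le_one
      · rw [uIoc_of_le zero_le_one]
        exact ((continuousOn_finsetSum _ fun i _ => (cDu hv₀' i).mul (cd hv₀' _ i)).mono
          Ioc_subset_Icc_self).aestronglyMeasurable measurableSet_Ioc
      · refine ae_of_all _ fun u hu => ?_
        rw [uIoc_of_le zero_le_one] at hu
        have hu' := Ioc_subset_Icc_self hu
        refine LipschitzOnWith.of_dist_le_mul fun v hv v' hv' => ?_
        rw [dist_eq_norm, dist_eq_norm]
        calc ‖(∑ i, Du i (u, v₀) * (σ (u, v) i - σ (u, v₀) i)) -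
              ∑ i, Du i (u, v₀) * (σ (u, v') i - σ (u, v₀) i)‖
            = ‖∑ i, Du i (u, v₀) * (σ (u, v) i - σ (u, v') i)‖ := by
              rw [← Finset.sum_sub_distrib]
              congr 1
              exact Finset.sum_congr rfl fun i _ => by ring
          _ ≤ ∑ i, ‖Du i (u, v₀)‖ * ‖σ (u, v) i - σ (u, v') i‖ :=
              norm_sum_le_of_le _ fun i _ => by rw [norm_mul]
          _ ≤ ∑ i, ‖Du i (u, v₀)‖ * (M₁ * ‖v - v'‖) :=
              Finset.sum_le_sum fun i _ => mul_le_mul_of_nonneg_left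
                ((norm_le_pi_norm (σ (u, v) - σ (u, v')) i).trans (hMVσ hu' hv hv'))
                (norm_nonneg _)
          _ = (∑ i, ‖Du i (u, v₀)‖) * (M₁ * ‖v - v'‖) := by rw [Finset.sum_mul]
          _ ≤ L₂ * (M₁ * ‖v - v'‖) :=
              mul_le_mul_of_nonneg_right (hL₂' (u, v₀) (mk_mem_prod hu' hv₀'))
                (mul_nonneg hM₁nn (norm_nonneg _))
          _ = (L₂ * M₁) * ‖v - v'‖ := by ring
          _ ≤ (Real.nnabs (L₂ * M₁) : ℝ) * ‖v - v'‖ :=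
              mul_le_mul_of_nonneg_right (by rw [Real.coe_nnabs]; exact le_abs_self _)
                (norm_nonneg _)
      · exact intervalIntegrable_const
      · refine ae_of_all _ fun u hu => ?_
        rw [uIoc_of_le zero_le_one] at hu
        exact HasDerivAt.fun_sum fun i _ =>
          ((hasDerivAt_slice_snd hσ (Ioc_subset_Icc_self hu) hv₀ i).sub_const _).const_mul _
    -- (D1): differentiation under the integral sign at `v₀`, one-point Lipschitz case
    have hD1 : HasDerivAt T1 (∫ u in (0 : ℝ)..1, ∑ i, Dv i (u, v₀) * σ' (u, v₀) (1, 0) i) v₀ := by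
      rw [hT1]
      simp only [intervalIntegral.integral_of_le zero_le_one]
      refine hasDerivAt_integral_of_dominated_loc_of_lip_pt (s := Icc 0 1)
        (F := fun v u => ∑ i, (eval (σ (u, v)) (ω i) - eval (σ (u, v₀)) (ω i)) * σ' (u, v) (1, 0) i)
        (bound := fun _ => n * (L₁ * M₂)) hnhds ?_ ?_ ?_ ?_ ?_ ?_
      · intro v hv
        exact ((continuousOn_finsetSum _ fun i _ => ((cev hv _).sub (cev hv₀' _)).mul
          (cd hv _ i)).mono Ioc_subset_Icc_self).aestronglyMeasurable measurableSet_Ioc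
      · have h0 : (fun u => ∑ i, (eval (σ (u, v₀)) (ω i) - eval (σ (u, v₀)) (ω i)) *
            σ' (u, v₀) (1, 0) i) = fun _ => 0 := by
          funext u; simp
        rw [h0]; exact integrable_zero _ _ _
      · exact ((continuousOn_finsetSum _ fun i _ => (cDv hv₀' i).mul (cd hv₀' _ i)).mono
          Ioc_subset_Icc_self).aestronglyMeasurable measurableSet_Ioc
      · rw [ae_restrict_iff' measurableSet_Ioc]
        refine ae_of_all _ fun u hu v hv => ?_
        have hu' := Ioc_subset_Icc_self hu
        have h0 : (∑ i, (eval (σ (u, v₀)) (ω i) - eval (σ (u, v₀)) (ω i)) *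
            σ' (u, v₀) (1, 0) i) = 0 := by simp
        rw [h0, sub_zero]
        calc ‖∑ i, (eval (σ (u, v)) (ω i) - eval (σ (u, v₀)) (ω i)) * σ' (u, v) (1, 0) i‖
            ≤ ∑ i, ‖eval (σ (u, v)) (ω i) - eval (σ (u, v₀)) (ω i)‖ * ‖σ' (u, v) (1, 0) i‖ :=
              norm_sum_le_of_le _ fun i _ => by rw [norm_mul]
          _ ≤ ∑ _i : Fin n, (L₁ * ‖v - v₀‖) * M₂ :=
              Finset.sum_le_sum fun i _ => mul_le_mul (hMVev hu' hv hv₀' i)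
                ((norm_le_pi_norm _ i).trans (hM₂ (u, v) (mk_mem_prod hu' hv))) (norm_nonneg _)
                (mul_nonneg hL₁nn (norm_nonneg _))
          _ = n * (L₁ * M₂) * ‖v - v₀‖ := by
              rw [Finset.sum_const, Finset.card_univ, Fintype.card_fin, nsmul_eq_mul]
              ring
      · exact integrableOn_const measure_Ioc_lt_top.ne
      · rw [ae_restrict_iff' measurableSet_Ioc]
        refine ae_of_all _ fun u hu => ?_
        have hu' := Ioc_subset_Icc_self hu
        refine HasDerivAt.fun_sum fun i _ => ?_
        refine hasDerivAt_mul_of_eq_zero (((hd_ev_v hu' hv₀' i).hasDerivAt hnhds).sub_const _)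
          (by simp) ?_
        exact ((continuousOn_slice_snd (hc_d (1, 0) i) hu').continuousWithinAt hv₀').continuousAt
          hnhds
    -- combine: the `dω`-terms cancel by `hiso`
    have hisoI : (∫ u in (0 : ℝ)..1, ∑ i, Dv i (u, v₀) * σ' (u, v₀) (1, 0) i) =
        ∫ u in (0 : ℝ)..1, ∑ i, Du i (u, v₀) * σ' (u, v₀) (0, 1) i := by
      refine intervalIntegral.integral_congr fun u hu => ?_
      rw [uIcc_of_le zero_le_one] at hu
      have h := hiso (u, v₀) (mk_mem_prod hu hv₀')
      simpa only [hDu, hDv] using h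
    have hcomb := (hD1.sub hD2).add hD3
    rw [hisoI, sub_self, zero_add] at hcomb
    have heq : (fun v => ∫ u in (0 : ℝ)..1, H (u, v)) =ᶠ[𝓝 v₀]
        fun v => (∫ u in (0 : ℝ)..1, H (u, v₀)) + (T1 v - T2 v + T3 v) := by
      filter_upwards [hnhds] with v hv using hBP v hv
    exact (hcomb.const_add (∫ u in (0 : ℝ)..1, H (u, v₀))).congr_of_eventuallyEq heq
  ---------------------------------------------------------------------------------------------
  -- Step 3: the fundamental theorem of calculus in `v`.
  ---------------------------------------------------------------------------------------------
  have hG1 : IntervalIntegrable (fun v => G (1, v)) volume 0 1 :=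
    (continuousOn_slice_snd hcG h11).intervalIntegrable_of_Icc zero_le_one
  have hG0 : IntervalIntegrable (fun v => G (0, v)) volume 0 1 :=
    (continuousOn_slice_snd hcG h01).intervalIntegrable_of_Icc zero_le_one
  have hFTC := intervalIntegral.integral_eq_sub_of_hasDerivAt_of_le zero_le_one hJ hJ'
    (hG1.sub hG0)
  have hsub := intervalIntegral.integral_sub hG1 hG0
  have final : (∫ u in (0 : ℝ)..1, H (u, 0)) - (∫ u in (0 : ℝ)..1, H (u, 1)) +
      ((∫ v in (0 : ℝ)..1, G (1, v)) - ∫ v in (0 : ℝ)..1, G (0, v)) = 0 := by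
    rw [← hsub, hFTC]
    ring
  simpa only [hH, hG] using final

end Square

/-! ### From the square to period symbols -/

/-- The period of a symbol computed from any parametrisation `g` that agrees with the path on
`[0,1]` and any choice of derivatives `g′` of `g` on `(0,1)`. [folklore] -/
theorem PeriodSymbol.period_eq_of_hasDerivAt (s : PeriodSymbol) (g g' : ℝ → (Fin s.Z.n → ℂ))
    (hg : ∀ t ∈ Icc (0 : ℝ) 1, s.γ.toFun t = g t)
    (hg' : ∀ t ∈ Ioo (0 : ℝ) 1, ∀ i, HasDerivAt (fun u => g u i) (g' t i) t) :
    s.period = ∫ t in (0 : ℝ)..1, ∑ i, eval (g t) (s.ω i) * g' t i := by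
  rw [PeriodSymbol.period_eq_integral_Ioo, intervalIntegral.integral_of_le zero_le_one,
    integral_Ioc_eq_integral_Ioo]
  refine setIntegral_congr_fun measurableSet_Ioo fun t ht => ?_
  have hγg : s.γ.toFun =ᶠ[𝓝 t] g := by
    filter_upwards [Icc_mem_nhds ht.1 ht.2] with u hu using hg u hu
  rw [hg t (Ioo_subset_Icc_self ht)]
  refine Finset.sum_congr rfl fun i _ => ?_
  congr 1
  have h1 : HasDerivAt (fun u => s.γ.toFun u i) (g' t i) t :=
    (hg' t ht i).congr_of_eventuallyEq (hγg.mono fun u hu => congrFun hu i)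
  exact h1.deriv

/-- Partial derivatives of a `C¹` map of the square into `Z` are tangent to `Z` (horizontal
direction). [folklore] -/
theorem slice_deriv_fst_mem_tangentSpace {Z : CurveData} {σ : ℝ × ℝ → (Fin Z.n → ℂ)}
    {σ' : ℝ × ℝ → (ℝ × ℝ →L[ℝ] (Fin Z.n → ℂ))}
    (hσ : ∀ p ∈ Icc (0 : ℝ) 1 ×ˢ Icc (0 : ℝ) 1, HasFDerivWithinAt σ (σ' p) (Icc 0 1 ×ˢ Icc 0 1) p)
    (hσZ : MapsTo σ (Icc (0 : ℝ) 1 ×ˢ Icc (0 : ℝ) 1) Z.points) {u v : ℝ}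
    (hu : u ∈ Icc (0 : ℝ) 1) (hv : v ∈ Icc (0 : ℝ) 1) :
    σ' (u, v) (1, 0) ∈ Z.tangentSpace (σ (u, v)) := by
  intro j
  have hD : HasDerivWithinAt (fun u => eval (σ (u, v)) (Z.F j))
      (∑ i, eval (σ (u, v)) (pderiv i (Z.F j)) * σ' (u, v) (1, 0) i) (Icc 0 1) u :=
    hasDerivWithinAt_eval_comp (γ := fun u => σ (u, v))
      (fun i => hasDerivWithinAt_slice_fst hσ hu hv i) (Z.F j)
  have hD0 : HasDerivWithinAt (fun u => eval (σ (u, v)) (Z.F j)) 0 (Icc 0 1) u :=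
    (hasDerivWithinAt_const u _ (0 : ℂ)).congr
      (fun u' hu' => (CurveData.mem_points.1 (hσZ (mk_mem_prod hu' hv))) j)
      ((CurveData.mem_points.1 (hσZ (mk_mem_prod hu hv))) j)
  have h := (uniqueDiffOn_Icc zero_lt_one u hu).eq_deriv _ hD hD0
  simpa [CurveData.gradient] using h

/-- Partial derivatives of a `C¹` map of the square into `Z` are tangent to `Z` (vertical
direction). [folklore] -/
theorem slice_deriv_snd_mem_tangentSpace {Z : CurveData} {σ : ℝ × ℝ → (Fin Z.n → ℂ)}
    {σ' : ℝ × ℝ → (ℝ × ℝ →L[ℝ] (Fin Z.n → ℂ))}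
    (hσ : ∀ p ∈ Icc (0 : ℝ) 1 ×ˢ Icc (0 : ℝ) 1, HasFDerivWithinAt σ (σ' p) (Icc 0 1 ×ˢ Icc 0 1) p)
    (hσZ : MapsTo σ (Icc (0 : ℝ) 1 ×ˢ Icc (0 : ℝ) 1) Z.points) {u v : ℝ}
    (hu : u ∈ Icc (0 : ℝ) 1) (hv : v ∈ Icc (0 : ℝ) 1) :
    σ' (u, v) (0, 1) ∈ Z.tangentSpace (σ (u, v)) := by
  intro j
  have hD : HasDerivWithinAt (fun v => eval (σ (u, v)) (Z.F j))
      (∑ i, eval (σ (u, v)) (pderiv i (Z.F j)) * σ' (u, v) (0, 1) i) (Icc 0 1) v :=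
    hasDerivWithinAt_eval_comp (γ := fun v => σ (u, v))
      (fun i => hasDerivWithinAt_slice_snd hσ hu hv i) (Z.F j)
  have hD0 : HasDerivWithinAt (fun v => eval (σ (u, v)) (Z.F j)) 0 (Icc 0 1) v :=
    (hasDerivWithinAt_const v _ (0 : ℂ)).congr
      (fun v' hv' => (CurveData.mem_points.1 (hσZ (mk_mem_prod hu hv'))) j)
      ((CurveData.mem_points.1 (hσZ (mk_mem_prod hu hv))) j)
  have h := (uniqueDiffOn_Icc zero_lt_one v hv).eq_deriv _ hD hD0
  simpa [CurveData.gradient] using h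

/-- **Stokes on the square for maps into a smooth affine curve**: for a `C¹` map `σ` of the
closed unit square into `Z` and a polynomial 1-form `ω`, the boundary integral of `σ^*ω`
vanishes (the tangent space of `Z` being a complex line, `dω(∂ᵤσ, ∂ᵥσ) = 0`). [folklore] -/
theorem square_stokes_of_mapsTo {Z : CurveData} (hZ : Z.IsSmoothAffineCurve)
    (ω : Fin Z.n → MvPolynomial (Fin Z.n) ℂ) {σ : ℝ × ℝ → (Fin Z.n → ℂ)}
    {σ' : ℝ × ℝ → (ℝ × ℝ →L[ℝ] (Fin Z.n → ℂ))}
    (hσ : ∀ p ∈ Icc (0 : ℝ) 1 ×ˢ Icc (0 : ℝ) 1, HasFDerivWithinAt σ (σ' p) (Icc 0 1 ×ˢ Icc 0 1) p)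
    (hσ' : ContinuousOn σ' (Icc (0 : ℝ) 1 ×ˢ Icc (0 : ℝ) 1))
    (hσZ : MapsTo σ (Icc (0 : ℝ) 1 ×ˢ Icc (0 : ℝ) 1) Z.points) :
    (∫ u in (0 : ℝ)..1, ∑ i, eval (σ (u, 0)) (ω i) * σ' (u, 0) (1, 0) i) -
        (∫ u in (0 : ℝ)..1, ∑ i, eval (σ (u, 1)) (ω i) * σ' (u, 1) (1, 0) i) +
      ((∫ v in (0 : ℝ)..1, ∑ i, eval (σ (1, v)) (ω i) * σ' (1, v) (0, 1) i) -
        (∫ v in (0 : ℝ)..1, ∑ i, eval (σ (0, v)) (ω i) * σ' (0, v) (0, 1) i)) = 0 := by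
  refine square_stokes ω hσ hσ' fun p hp => ?_
  obtain ⟨u, v⟩ := p
  have hu : u ∈ Icc (0 : ℝ) 1 := hp.1
  have hv : v ∈ Icc (0 : ℝ) 1 := hp.2
  have hx := slice_deriv_fst_mem_tangentSpace hσ hσZ hu hv
  have hy := slice_deriv_snd_mem_tangentSpace hσ hσZ hu hv
  have hz : σ (u, v) ∈ Z.points := hσZ (mk_mem_prod hu hv)
  simp_rw [Finset.sum_mul]
  refine Finset.sum_congr rfl fun i _ => Finset.sum_congr rfl fun j _ => ?_
  rw [mul_assoc, mul_assoc, tangent_parallel hZ hz hy hx i j]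

/-! ### (R5) Boundaries of `C¹` triangles -/

/-- **(R5)** `∫_{e₀₁} ω + ∫_{e₁₂} ω − ∫_{e₀₂} ω = 0` for the three edges of a `C¹` map `τ` of the
standard triangle into a smooth affine curve `Z` (book §3.3: the period pairing is well defined
on homology by Stokes' theorem; here for `C¹` simplices, pulling the triangle back to the square
along `(u, v) ↦ ((1 − v)u, v)`). [cite: HuberWustholz2022, §3.3 (p. 42)] -/
theorem period_boundary (Z : CurveData) (hZ : Z.IsSmoothAffineCurve)
    (ω : Fin Z.n → MvPolynomial (Fin Z.n) ℂ) (h : ∀ i, HasAlgCoeffs (ω i))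
    (τ : ℝ × ℝ → (Fin Z.n → ℂ)) (hτ : ContDiffOn ℝ 1 τ stdTriangle)
    (hτZ : Set.MapsTo τ stdTriangle Z.points) (e₀₁ e₁₂ e₀₂ : CurvePath Z)
    (h₀₁ : ∀ t ∈ Set.Icc (0 : ℝ) 1, e₀₁.toFun t = τ (t, 0))
    (h₁₂ : ∀ t ∈ Set.Icc (0 : ℝ) 1, e₁₂.toFun t = τ (1 - t, t))
    (h₀₂ : ∀ t ∈ Set.Icc (0 : ℝ) 1, e₀₂.toFun t = τ (0, t)) :
    (⟨Z, hZ, ω, h, e₀₁⟩ : PeriodSymbol).period + (⟨Z, hZ, ω, h, e₁₂⟩ : PeriodSymbol).period -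
      (⟨Z, hZ, ω, h, e₀₂⟩ : PeriodSymbol).period = 0 := by
  -- the collapsing map `Φ(u, v) = ((1 − v)u, v)` of the square onto the triangle
  obtain ⟨Φ, hΦdef⟩ : ∃ Φ : ℝ × ℝ → ℝ × ℝ, Φ = fun p => ((1 - p.2) * p.1, p.2) := ⟨_, rfl⟩
  obtain ⟨Φ', hΦ'def⟩ : ∃ Φ' : ℝ × ℝ → (ℝ × ℝ →L[ℝ] ℝ × ℝ), Φ' = fun p =>
      ContinuousLinearMap.id ℝ (ℝ × ℝ) -
        p.2 • (ContinuousLinearMap.inl ℝ ℝ ℝ).comp (ContinuousLinearMap.fst ℝ ℝ ℝ) -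
        p.1 • (ContinuousLinearMap.inl ℝ ℝ ℝ).comp (ContinuousLinearMap.snd ℝ ℝ ℝ) := ⟨_, rfl⟩
  have hΦ'apply : ∀ (p : ℝ × ℝ) (a b : ℝ), Φ' p (a, b) = ((1 - p.2) * a - p.1 * b, b) := by
    intro p a b
    rw [hΦ'def]
    simp only [sub_apply, smul_apply, ContinuousLinearMap.coe_id', id_eq,
      ContinuousLinearMap.comp_apply, ContinuousLinearMap.coe_fst', ContinuousLinearMap.coe_snd',
      ContinuousLinearMap.inl_apply, Prod.smul_mk, smul_eq_mul, mul_zero, Prod.mk_sub_mk,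
      sub_zero, Prod.mk.injEq]
    exact ⟨by ring, trivial⟩
  have hΦ : ∀ p, HasFDerivAt Φ (Φ' p) p := by
    intro p
    have h1 : HasFDerivAt (fun q : ℝ × ℝ => (1 - q.2) * q.1)
        ((1 - p.2) • ContinuousLinearMap.fst ℝ ℝ ℝ +
          p.1 • ((0 : ℝ × ℝ →L[ℝ] ℝ) - ContinuousLinearMap.snd ℝ ℝ ℝ)) p :=
      ((hasFDerivAt_const (1 : ℝ) p).sub hasFDerivAt_snd).mul hasFDerivAt_fst
    have h2 := h1.prodMk (hasFDerivAt_snd (p := p) (𝕜 := ℝ))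
    rw [hΦdef]
    refine h2.congr_fderiv (ContinuousLinearMap.ext fun q => ?_)
    obtain ⟨a, b⟩ := q
    rw [hΦ'apply]
    simp only [ContinuousLinearMap.prod_apply, add_apply, smul_apply,
      ContinuousLinearMap.coe_fst', sub_apply, zero_apply, ContinuousLinearMap.coe_snd',
      smul_eq_mul, Prod.mk.injEq]
    exact ⟨by ring, trivial⟩
  have hΦc : Continuous Φ := by
    rw [hΦdef]
    exact ((continuous_const.sub continuous_snd).mul continuous_fst).prodMk continuous_snd
  have hΦ'c : Continuous Φ' := by
    rw [hΦ'def]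
    exact (continuous_const.sub (continuous_snd.smul continuous_const)).sub
      (continuous_fst.smul continuous_const)
  have hΦS : MapsTo Φ (Icc (0 : ℝ) 1 ×ˢ Icc (0 : ℝ) 1) stdTriangle := by
    rintro ⟨u, v⟩ ⟨⟨hu0, hu1⟩, ⟨hv0, hv1⟩⟩
    simp only [hΦdef, stdTriangle, mem_setOf_eq]
    refine ⟨mul_nonneg (by linarith) hu0, hv0, ?_⟩
    nlinarith
  -- `τ` and its one-sided derivative on the triangle
  have hτ' : ∀ q ∈ stdTriangle, HasFDerivWithinAt τ (fderivWithin ℝ τ stdTriangle q) stdTriangle q :=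
    fun q hq => (hτ.differentiableOn one_ne_zero q hq).hasFDerivWithinAt
  have hτ'c : ContinuousOn (fderivWithin ℝ τ stdTriangle) stdTriangle :=
    hτ.continuousOn_fderivWithin uniqueDiffOn_stdTriangle le_rfl
  -- `σ = τ ∘ Φ` on the square
  have hσ : ∀ p ∈ Icc (0 : ℝ) 1 ×ˢ Icc (0 : ℝ) 1, HasFDerivWithinAt (fun p => τ (Φ p))
      ((fderivWithin ℝ τ stdTriangle (Φ p)).comp (Φ' p)) (Icc 0 1 ×ˢ Icc 0 1) p :=
    fun p hp => (hτ' (Φ p) (hΦS hp)).comp p (hΦ p).hasFDerivWithinAt hΦS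
  have hσ' : ContinuousOn (fun p => (fderivWithin ℝ τ stdTriangle (Φ p)).comp (Φ' p))
      (Icc (0 : ℝ) 1 ×ˢ Icc (0 : ℝ) 1) :=
    (hτ'c.comp hΦc.continuousOn hΦS).clm_comp hΦ'c.continuousOn
  have hσZ : MapsTo (fun p => τ (Φ p)) (Icc (0 : ℝ) 1 ×ˢ Icc (0 : ℝ) 1) Z.points :=
    fun p hp => hτZ (hΦS hp)
  have hE := square_stokes_of_mapsTo hZ ω hσ hσ' hσZ
  -- values of `Φ` and `Φ′` on the four edges
  have hΦb : ∀ u : ℝ, Φ (u, 0) = (u, 0) := fun u => by simp [hΦdef]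
  have hΦt : ∀ u : ℝ, Φ' (u, 1) (1, 0) = 0 := fun u => by
    rw [hΦ'apply]; simp
  have hΦr : ∀ v : ℝ, Φ (1, v) = (1 - v, v) := fun v => by simp [hΦdef]
  have hΦl : ∀ v : ℝ, Φ (0, v) = (0, v) := fun v => by simp [hΦdef]
  -- the top edge contributes nothing
  have htop : (∫ u in (0 : ℝ)..1, ∑ i, eval (τ (Φ (u, 1))) (ω i) *
      ((fderivWithin ℝ τ stdTriangle (Φ (u, 1))).comp (Φ' (u, 1))) (1, 0) i) = 0 := by
    simp [ContinuousLinearMap.comp_apply, hΦt]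
  -- the three edges are the three paths
  have hg₁ : ∀ t ∈ Icc (0 : ℝ) 1, e₀₁.toFun t = τ (Φ (t, 0)) := fun t ht => by
    rw [hΦb, h₀₁ t ht]
  have hg₁' : ∀ t ∈ Ioo (0 : ℝ) 1, ∀ i, HasDerivAt (fun u => τ (Φ (u, 0)) i)
      (((fderivWithin ℝ τ stdTriangle (Φ (t, 0))).comp (Φ' (t, 0))) (1, 0) i) t :=
    fun t ht i => hasDerivAt_slice_fst hσ ht ⟨le_rfl, zero_le_one⟩ i
  have h1 : (⟨Z, hZ, ω, h, e₀₁⟩ : PeriodSymbol).period = ∫ u in (0 : ℝ)..1,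
      ∑ i, eval (τ (Φ (u, 0))) (ω i) *
        ((fderivWithin ℝ τ stdTriangle (Φ (u, 0))).comp (Φ' (u, 0))) (1, 0) i :=
    PeriodSymbol.period_eq_of_hasDerivAt ⟨Z, hZ, ω, h, e₀₁⟩ (fun u => τ (Φ (u, 0)))
      (fun u => ((fderivWithin ℝ τ stdTriangle (Φ (u, 0))).comp (Φ' (u, 0))) (1, 0)) hg₁ hg₁'
  have hg₂ : ∀ t ∈ Icc (0 : ℝ) 1, e₁₂.toFun t = τ (Φ (1, t)) := fun t ht => by
    rw [hΦr, h₁₂ t ht]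
  have hg₂' : ∀ t ∈ Ioo (0 : ℝ) 1, ∀ i, HasDerivAt (fun v => τ (Φ (1, v)) i)
      (((fderivWithin ℝ τ stdTriangle (Φ (1, t))).comp (Φ' (1, t))) (0, 1) i) t :=
    fun t ht i => hasDerivAt_slice_snd hσ ⟨zero_le_one, le_rfl⟩ ht i
  have h2 : (⟨Z, hZ, ω, h, e₁₂⟩ : PeriodSymbol).period = ∫ v in (0 : ℝ)..1,
      ∑ i, eval (τ (Φ (1, v))) (ω i) *
        ((fderivWithin ℝ τ stdTriangle (Φ (1, v))).comp (Φ' (1, v))) (0, 1) i :=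
    PeriodSymbol.period_eq_of_hasDerivAt ⟨Z, hZ, ω, h, e₁₂⟩ (fun v => τ (Φ (1, v)))
      (fun v => ((fderivWithin ℝ τ stdTriangle (Φ (1, v))).comp (Φ' (1, v))) (0, 1)) hg₂ hg₂'
  have hg₃ : ∀ t ∈ Icc (0 : ℝ) 1, e₀₂.toFun t = τ (Φ (0, t)) := fun t ht => by
    rw [hΦl, h₀₂ t ht]
  have hg₃' : ∀ t ∈ Ioo (0 : ℝ) 1, ∀ i, HasDerivAt (fun v => τ (Φ (0, v)) i)
      (((fderivWithin ℝ τ stdTriangle (Φ (0, t))).comp (Φ' (0, t))) (0, 1) i) t :=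
    fun t ht i => hasDerivAt_slice_snd hσ ⟨le_rfl, zero_le_one⟩ ht i
  have h3 : (⟨Z, hZ, ω, h, e₀₂⟩ : PeriodSymbol).period = ∫ v in (0 : ℝ)..1,
      ∑ i, eval (τ (Φ (0, v))) (ω i) *
        ((fderivWithin ℝ τ stdTriangle (Φ (0, v))).comp (Φ' (0, v))) (0, 1) i :=
    PeriodSymbol.period_eq_of_hasDerivAt ⟨Z, hZ, ω, h, e₀₂⟩ (fun v => τ (Φ (0, v)))
      (fun v => ((fderivWithin ℝ τ stdTriangle (Φ (0, v))).comp (Φ' (0, v))) (0, 1)) hg₃ hg₃'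
  rw [h1, h2, h3]
  rw [htop, sub_zero] at hE
  linear_combination hE

/-- The relation **(R5)** `boundary` evaluates to `0`. [cite: HuberWustholz2022, §3.3 (p. 42)] -/
theorem evalCombination_rel_boundary (Z : CurveData) (hZ : Z.IsSmoothAffineCurve)
    (ω : Fin Z.n → MvPolynomial (Fin Z.n) ℂ) (h : ∀ i, HasAlgCoeffs (ω i))
    (τ : ℝ × ℝ → (Fin Z.n → ℂ)) (hτ : ContDiffOn ℝ 1 τ stdTriangle)
    (hτZ : Set.MapsTo τ stdTriangle Z.points) (e₀₁ e₁₂ e₀₂ : CurvePath Z)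
    (h₀₁ : ∀ t ∈ Set.Icc (0 : ℝ) 1, e₀₁.toFun t = τ (t, 0))
    (h₁₂ : ∀ t ∈ Set.Icc (0 : ℝ) 1, e₁₂.toFun t = τ (1 - t, t))
    (h₀₂ : ∀ t ∈ Set.Icc (0 : ℝ) 1, e₀₂.toFun t = τ (0, t)) :
    evalCombination
      (Finsupp.single ⟨Z, hZ, ω, h, e₀₁⟩ 1 + Finsupp.single ⟨Z, hZ, ω, h, e₁₂⟩ 1 -
        Finsupp.single ⟨Z, hZ, ω, h, e₀₂⟩ 1) = 0 := by
  rw [sub_eq_add_neg, evalCombination_add, evalCombination_add,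
    ← neg_one_smul ℂ (Finsupp.single (⟨Z, hZ, ω, h, e₀₂⟩ : PeriodSymbol) (1 : ℂ)),
    evalCombination_smul, evalCombination_single, evalCombination_single,
    evalCombination_single]
  have hb := period_boundary Z hZ ω h τ hτ hτZ e₀₁ e₁₂ e₀₂ h₀₁ h₁₂ h₀₂
  linear_combination hb

/-! ### The easy direction of Huber–Wüstholz, Theorem 13.3 (2) -/

/-- **Every elementary relation evaluates to zero**: the relations (R1)–(R5) "induced by
bilinearity and functoriality" are genuine relations between the periods `∫_γ ω`
(Huber–Wüstholz 2022, §13.1: "There is a short list of obvious relations").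
[cite: HuberWustholz2022, §13.1 (A)–(B) (p. 120), §3.3 (p. 42)] -/
theorem IsElementaryRelation.evalCombination_eq_zero {ρ : PeriodSymbol →₀ ℂ}
    (hρ : IsElementaryRelation ρ) : evalCombination ρ = 0 := by
  cases hρ with
  | add Z hZ γ ω ω₁ ω₂ h h₁ h₂ hω => exact evalCombination_rel_add Z hZ γ ω ω₁ ω₂ h h₁ h₂ hω
  | smul Z hZ γ a ha ω ω' h h' hω => exact evalCombination_rel_smul Z hZ γ a ω ω' h h' hω
  | vanish Z hZ γ ω h hv => exact evalCombination_rel_vanish Z hZ γ ω h hv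
  | exact Z hZ γ P hP ω h hω => exact evalCombination_rel_exact Z hZ γ P ω h hω
  | pushforward Z Z' hZ hZ' f hf hfZ ω' h' ω h hω γ γ' hγ' =>
    exact evalCombination_rel_pushforward Z Z' hZ hZ' f ω' h' ω h hω γ γ' hγ'
  | boundary Z hZ ω h τ hτ hτZ e₀₁ e₁₂ e₀₂ h₀₁ h₁₂ h₀₂ =>
    exact evalCombination_rel_boundary Z hZ ω h τ hτ hτZ e₀₁ e₁₂ e₀₂ h₀₁ h₁₂ h₀₂

/-- **The easy direction of Huber–Wüstholz 2022, Theorem 13.3 (2)** in the elementary rendering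
of `CurvePeriods.lean`: every linear combination of elementary relations (R1)–(R5) is a relation
between periods of curve type, i.e. lies in the kernel of the evaluation map. The named fact
`HuberWustholzCurvePeriods` is the converse inclusion (for algebraic coefficients).
[cite: HuberWustholz2022, §13.1 (p. 120), Thm. 13.3 (2) (p. 121)] -/
theorem evalCombination_eq_zero_of_isElementaryRelation {k : ℕ}
    (ρ : Fin k → (PeriodSymbol →₀ ℂ)) (a : Fin k → ℂ) (hρ : ∀ l, IsElementaryRelation (ρ l)) :
    evalCombination (∑ l, a l • ρ l) = 0 := by
  have hsum : ∀ (s : Finset (Fin k)), evalCombination (∑ l ∈ s, a l • ρ l) = 0 := by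
    intro s
    induction s using Finset.induction_on with
    | empty => simp [evalCombination]
    | insert l s hl ih =>
      rw [Finset.sum_insert hl, evalCombination_add, evalCombination_smul, ih,
        (hρ l).evalCombination_eq_zero, mul_zero, zero_add]
  exact hsum Finset.univ

end CurvePeriods

/-- **Kernel of the evaluation map = span of the elementary relations, granted the named fact.**
For a combination with algebraic coefficients, `Σ c_s ∫_{γ_s} ω_s = 0` holds if and only if `c`
is a `ℚ̄`-combination of elementary relations (R1)–(R5): "only if" is the named fact
`HuberWustholzCurvePeriods` (Huber–Wüstholz 2022, Thm. 13.3 (2)), "if" is the proved easy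
direction `CurvePeriods.evalCombination_eq_zero_of_isElementaryRelation`.
[cite: HuberWustholz2022, Thm. 13.3 (2) (p. 121), §13.1 (p. 120)] -/
theorem HuberWustholzCurvePeriods.evalCombination_eq_zero_iff (h : HuberWustholzCurvePeriods)
    (c : CurvePeriods.PeriodSymbol →₀ ℂ) (hc : ∀ s, IsAlgebraic ℚ (c s)) :
    CurvePeriods.evalCombination c = 0 ↔
      ∃ (k : ℕ) (ρ : Fin k → (CurvePeriods.PeriodSymbol →₀ ℂ)) (a : Fin k → ℂ),
        (∀ l, CurvePeriods.IsElementaryRelation (ρ l)) ∧ (∀ l, IsAlgebraic ℚ (a l)) ∧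
          c = ∑ l, a l • ρ l :=
  ⟨h c hc, fun ⟨_, ρ, a, hρ, _, hc'⟩ =>
    hc' ▸ CurvePeriods.evalCombination_eq_zero_of_isElementaryRelation ρ a hρ⟩

end Literature.NumberTheory.Transcendental

end
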